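import Summits.CriticalPhenomena.PercolationContinuityZ3.Theorems.PercNearOneGluingNoHeavyLowerTailSahiStrongCubicMax
import Mathlib.Tactic.Linarith
import Mathlib.Tactic.Ring
import HarnessLib

/-!
# `NoHeavyLowerTail` (crux stmt-CriticalPhenomena-4575), master-family line P1 (gen 21):
# PRODUCT FORM of the one-payer dichotomy — S₃^max is a "second-order Harris" disjunction for sunflowers

Support file (seat `prim-masterthm-p1`, gen 21; `--supports stmt-CriticalPhenomena-4575`).  No definition, no `sorry`,
standard axioms.  Memo `run/shared/lean/prim/prim-masterthm/FROM-prim-masterthm-p1-g21-PRODUCT-FORM.md` §1.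

SETTING (tree `SahiDeepCore`, gens 10–16): a sandwiched triple `(A,B,N)` of up-sets (`A∖B ⊆ N`, `B∖A ⊆ N`, `N ⊆ A∪B`) with
cells `α, β, d` (petals `A∖B, B∖A, (A∩B)∖N`), `κ` (core `A∩B∩N`), `o` (outside `(A∪B)ᶜ`), `e₂ = αβ+αd+βd`, `e₃ = αβd`,
Gladkov defect `G = κo − e₂ ≥ 0`; conjecture S₃^max (`strongCubicMax = max(κ,o)·G − e₃ ≥ 0`, typed `StrongCubicMaxNonneg`).

NEW HERE — the two one-sided slacks are DIFFERENCES OF PRODUCTS OF PLAIN MASSES (no cells):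
* **outside slack** `o·G − e₃ = μ((A∪B)ᶜ)² − μ(Aᶜ)·μ(Bᶜ)·μ(Nᶜ)` (`outsideSlack_eq_prod`): the three DOWN-sets
  `Aᶜ, Bᶜ, Nᶜ` pairwise intersect exactly in the outside `O = (A∪B)ᶜ` (`O ∪ petal`), and "the outside pays"
  (`e₃ ≤ o·G`) says **`μ(Aᶜ)μ(Bᶜ)μ(Nᶜ) ≤ μ(O)²`**;
* **core slack** `κ·G − e₃ = μ(A∩B∩N)² − μ(A∩N)·μ(B∩N)·μ(A∩B)` (`coreSlack_eq_prod`): the three UP-sets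
  `A∩N, B∩N, A∩B` form a SUNFLOWER with kernel `K = A∩B∩N` (`K ∪ petal`), and "the core pays" says
  **`μ(A∩N)μ(B∩N)μ(A∩B) ≤ μ(K)²`**;
* hence (`strongCubicMax_nonneg_iff_prod`) **S₃^max ⟺ `μ(A∩N)μ(B∩N)μ(A∩B) ≤ μ(A∩B∩N)²  ∨  μ(Aᶜ)μ(Bᶜ)μ(Nᶜ) ≤ μ((A∪B)ᶜ)²`.**
  For TWO up-sets both analogues hold (Harris: `μ(U)μ(V) ≤ μ(U∩V)`, `μ(Uᶜ)μ(Vᶜ) ≤ μ(Uᶜ∩Vᶜ)`); for a 3-sunflower Harris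
  only gives `Π μ(U_i) ≤ μ(K)^{3/2}` (`prod_le_core_pow_three_halves_sq`), and the conjecture is that ONE of the two
  second-order inequalities (`≤ μ(K)²` / `≤ μ(O)²`) always holds — by `outside_sub_core_slack`, the one on the heavier side.
* sunflower reading (`coreSlack_sunflower`, `outsideSlack_sunflower`): for up-sets `X, Y, Z` with `X∩Y = X∩Z = Y∩Z`
  the triple `(X∪Z, Y∪Z, X∪Y)` is sandwiched with `A∩N = X ∪ (kernel)` etc.; stated for the co-sunflower of three
  arbitrary increasing events `G_i` in `strongCubicMax_coSunflower_iff_prod`.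
WHY IT MATTERS (memo §1–§3): (i) the known strata become one-liners (e.g. `O = {∅}`: `μ(O∪P_i)` factorises); (ii) the
Aharoni–Keich / Rinott–Saks three-function AD inequality applies verbatim to `1_{Aᶜ}, 1_{Bᶜ}, 1_{Nᶜ}` and proves the
outside branch whenever all cross-medians land in `O` (e.g. `O` a subcube = the union-OR stratum), giving in general
`μ(Aᶜ)μ(Bᶜ)μ(Nᶜ) ≤ μ(O)·μ(Med)`; (iii) the dichotomy is a statement about the 4 numbers `(μO; μAᶜ, μBᶜ, μNᶜ)` only.
HONEST FRAMING: identities and equivalences; S₃^max, S₃⁺, S₃ and the class law remain OPEN. [this work]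
-/

noncomputable section

open scoped Classical

namespace Summit.CriticalPhenomena.PercolationContinuityZ3.Theorems

namespace SahiDeepCore

open Literature.Combinatorics.Sahi2008
open Literature.Probability.Percolation (DeterminedBy determinedBy_iff)
open Literature.Probability.Percolation.DecisionTree (ind ind_of_mem ind_of_not_mem ind_nonneg)

variable {ι : Type} [Fintype ι]

local notation3 (prettyPrint := false) "m⟦" p ", " X "⟧" => ex (bernoulliWeight p) (ind X)

/-! ### 0. Mass bookkeeping -/

omit [Fintype ι] in
/-- Cell masses are nonnegative. [folklore] -/
private theorem mass_nonneg' [Fintype ι] (p : ι → unitInterval) (X : Set (Set ι)) : 0 ≤ m⟦p, X⟧ :=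
  ex_nonneg (isFKGMeasure_bernoulliWeight p).nonneg fun ω => ind_nonneg _ ω

omit [Fintype ι] in
/-- `1_{Xᶜ} = 1 − 1_X`. [folklore] -/
private theorem ind_compl_eq (X : Set (Set ι)) : ind Xᶜ = (fun _ => (1 : ℝ)) - ind X := by
  funext ω
  simp only [Pi.sub_apply]
  by_cases h : ω ∈ X
  · rw [ind_of_mem h, ind_of_not_mem (show ω ∉ Xᶜ from fun h' => h' h)]; norm_num
  · rw [ind_of_not_mem h, ind_of_mem (show ω ∈ Xᶜ from h)]; norm_num

/-- `μ(Xᶜ) = 1 − μ(X)`. [folklore] -/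
private theorem mass_compl (p : ι → unitInterval) (X : Set (Set ι)) : m⟦p, Xᶜ⟧ = 1 - m⟦p, X⟧ := by
  have h : ind Xᶜ + ind X = fun _ => (1 : ℝ) := by rw [ind_compl_eq]; funext ω; simp
  have := congrArg (ex (bernoulliWeight p)) h
  rw [ex_add, ex_const (sum_bernoulliWeight p)] at this
  linarith

/-- `μ(X) ≤ 1`. [folklore] -/
private theorem mass_le_one (p : ι → unitInterval) (X : Set (Set ι)) : m⟦p, X⟧ ≤ 1 := by
  have h := mass_nonneg' p Xᶜ
  rw [mass_compl] at h
  linarith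

/-- Harris for two increasing events, `μ(U)·μ(V) ≤ μ(U ∩ V)` (read off the tree's deep-core Harris inequality).
[cite: Harris1960, Lemma 4.1] -/
private theorem harris_inter (p : ι → unitInterval) {U V : Set (Set ι)} (hU : IsUpperSet U) (hV : IsUpperSet V) :
    m⟦p, U⟧ * m⟦p, V⟧ ≤ m⟦p, U ∩ V⟧ := by
  have h := deepCore_harris p hU hV
  have h' := mul_nonneg (mass_nonneg' p (deepCore U V)) (sub_nonneg.2 (mass_le_one p (U ∩ V)))
  linarith

omit [Fintype ι] in
/-- `1_N + 1_{A∩B∩N} = 1_{A∩N} + 1_{B∩N}` when `N ⊆ A ∪ B` (the two halves of `N` overlap in the core). [this work] -/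
private theorem ind_N_split {A B N : Set (Set ι)} (hN : N ⊆ A ∪ B) :
    ind N + ind (A ∩ B ∩ N) = ind (A ∩ N) + ind (B ∩ N) := by
  funext ω
  simp only [Pi.add_apply]
  by_cases hn : ω ∈ N
  · rw [ind_of_mem hn]
    by_cases ha : ω ∈ A <;> by_cases hb : ω ∈ B
    · rw [ind_of_mem (show ω ∈ A ∩ B ∩ N from ⟨⟨ha, hb⟩, hn⟩), ind_of_mem (show ω ∈ A ∩ N from ⟨ha, hn⟩),
        ind_of_mem (show ω ∈ B ∩ N from ⟨hb, hn⟩)]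
    · rw [ind_of_not_mem (show ω ∉ A ∩ B ∩ N from fun h => hb h.1.2), ind_of_mem (show ω ∈ A ∩ N from ⟨ha, hn⟩),
        ind_of_not_mem (show ω ∉ B ∩ N from fun h => hb h.1)]
    · rw [ind_of_not_mem (show ω ∉ A ∩ B ∩ N from fun h => ha h.1.1), ind_of_not_mem (show ω ∉ A ∩ N from fun h => ha h.1),
        ind_of_mem (show ω ∈ B ∩ N from ⟨hb, hn⟩)]; norm_num
    · exact absurd (hN hn) (fun h => h.elim ha hb)
  · rw [ind_of_not_mem hn, ind_of_not_mem (show ω ∉ A ∩ B ∩ N from fun h => hn h.2),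
      ind_of_not_mem (show ω ∉ A ∩ N from fun h => hn h.2), ind_of_not_mem (show ω ∉ B ∩ N from fun h => hn h.2)]

/-- **The sunflower masses in cells**: `μ(A∩N) = α + κ`, `μ(B∩N) = β + κ`, `μ(A∩B) = d + κ`, `μ(N) = α + β + κ`,
`μA = α + κ + d`, `μB = β + κ + d` for a sandwiched triple. [this work] -/
theorem sunflower_masses (p : ι → unitInterval) {A B N : Set (Set ι)} (hAB : A \ B ⊆ N) (hBA : B \ A ⊆ N)
    (hN : N ⊆ A ∪ B) :
    m⟦p, A ∩ N⟧ = m⟦p, A \ B⟧ + m⟦p, A ∩ B ∩ N⟧ ∧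
      m⟦p, B ∩ N⟧ = m⟦p, B \ A⟧ + m⟦p, A ∩ B ∩ N⟧ ∧
      m⟦p, A ∩ B⟧ = m⟦p, (A ∩ B) \ N⟧ + m⟦p, A ∩ B ∩ N⟧ ∧
      m⟦p, N⟧ = m⟦p, A \ B⟧ + m⟦p, B \ A⟧ + m⟦p, A ∩ B ∩ N⟧ ∧
      m⟦p, A⟧ = m⟦p, A \ B⟧ + m⟦p, A ∩ B ∩ N⟧ + m⟦p, (A ∩ B) \ N⟧ ∧
      m⟦p, B⟧ = m⟦p, B \ A⟧ + m⟦p, A ∩ B ∩ N⟧ + m⟦p, (A ∩ B) \ N⟧ := by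
  obtain ⟨hA, hT⟩ := cells_of_sandwich p hAB hN
  have hN' : N ⊆ B ∪ A := fun ω h => (hN h).symm
  obtain ⟨hB, hT'⟩ := cells_of_sandwich p hBA hN'
  rw [Set.inter_comm B A] at hB hT'
  have h1 := congrArg (ex (bernoulliWeight p)) (ind_sandwich_first hAB hN)
  have h2 := congrArg (ex (bernoulliWeight p)) (ind_sandwich_first hBA hN')
  rw [Set.inter_comm B A] at h2
  have h3 := congrArg (ex (bernoulliWeight p)) (ind_N_split hN)
  rw [ex_add, ex_add] at h1 h2 h3
  refine ⟨by linarith, by linarith, by linarith, by linarith, by linarith, by linarith⟩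

/-! ### 1. The two slacks as differences of products -/

/-- **OUTSIDE SLACK, PRODUCT FORM.**  For a sandwiched triple, `o·G − e₃ = μ((A∪B)ᶜ)² − μ(Aᶜ)·μ(Bᶜ)·μ(Nᶜ)`:
the three down-sets `Aᶜ = O ∪ (B∖A)`, `Bᶜ = O ∪ (A∖B)`, `Nᶜ = O ∪ ((A∩B)∖N)` pairwise meet exactly in the outside `O`,
and "the outside pays for all rainbows" (`e₃ ≤ o·G`) is `μ(Aᶜ)μ(Bᶜ)μ(Nᶜ) ≤ μ(O)²`.  (Uses only `α+β+κ+d+o = 1`.) [this work] -/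
theorem outsideSlack_eq_prod (p : ι → unitInterval) {A B N : Set (Set ι)} (hAB : A \ B ⊆ N) (hBA : B \ A ⊆ N)
    (hN : N ⊆ A ∪ B) :
    m⟦p, (A ∪ B)ᶜ⟧ * gladkovDefect p A B N - m⟦p, A \ B⟧ * m⟦p, B \ A⟧ * m⟦p, (A ∩ B) \ N⟧
      = m⟦p, (A ∪ B)ᶜ⟧ ^ 2 - m⟦p, Aᶜ⟧ * m⟦p, Bᶜ⟧ * m⟦p, Nᶜ⟧ := by
  obtain ⟨-, -, -, hNm, hAm, hBm⟩ := sunflower_masses p hAB hBA hN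
  have hsum := cells_sum_eq_one p A B N
  rw [mass_compl p A, mass_compl p B, mass_compl p N, hNm, hAm, hBm]
  have ho : m⟦p, (A ∪ B)ᶜ⟧ = 1 - (m⟦p, A \ B⟧ + m⟦p, B \ A⟧ + m⟦p, A ∩ B ∩ N⟧ + m⟦p, (A ∩ B) \ N⟧) := by linarith
  simp only [gladkovDefect]
  rw [ho]
  ring

/-- **CORE SLACK, PRODUCT FORM.**  For a sandwiched triple, `κ·G − e₃ = μ(A∩B∩N)² − μ(A∩N)·μ(B∩N)·μ(A∩B)`:
the three up-sets `A∩N = K ∪ (A∖B)`, `B∩N = K ∪ (B∖A)`, `A∩B = K ∪ ((A∩B)∖N)` form a SUNFLOWER with kernel the core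
`K = A∩B∩N`, and "the core pays for all rainbows" (`e₃ ≤ κ·G`) is `μ(A∩N)μ(B∩N)μ(A∩B) ≤ μ(K)²`. [this work] -/
theorem coreSlack_eq_prod (p : ι → unitInterval) {A B N : Set (Set ι)} (hAB : A \ B ⊆ N) (hBA : B \ A ⊆ N)
    (hN : N ⊆ A ∪ B) :
    m⟦p, A ∩ B ∩ N⟧ * gladkovDefect p A B N - m⟦p, A \ B⟧ * m⟦p, B \ A⟧ * m⟦p, (A ∩ B) \ N⟧
      = m⟦p, A ∩ B ∩ N⟧ ^ 2 - m⟦p, A ∩ N⟧ * m⟦p, B ∩ N⟧ * m⟦p, A ∩ B⟧ := by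
  obtain ⟨hANm, hBNm, hABm, -, -, -⟩ := sunflower_masses p hAB hBA hN
  have hsum := cells_sum_eq_one p A B N
  rw [hANm, hBNm, hABm]
  have ho : m⟦p, (A ∪ B)ᶜ⟧ = 1 - (m⟦p, A \ B⟧ + m⟦p, B \ A⟧ + m⟦p, A ∩ B ∩ N⟧ + m⟦p, (A ∩ B) \ N⟧) := by linarith
  simp only [gladkovDefect]
  rw [ho]
  ring

/-- **S₃^max IN PRODUCT FORM.**  Whenever `G ≥ 0` (e.g. for up-sets, `gladkovDefect_nonneg`):
`0 ≤ strongCubicMax` iff **`μ(A∩N)·μ(B∩N)·μ(A∩B) ≤ μ(A∩B∩N)²` (core pays) or `μ(Aᶜ)·μ(Bᶜ)·μ(Nᶜ) ≤ μ((A∪B)ᶜ)²`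
(outside pays)** — a "second-order Harris" dichotomy: for two up-sets both `μ(U)μ(V) ≤ μ(U∩V)` and
`μ(Uᶜ)μ(Vᶜ) ≤ μ(Uᶜ∩Vᶜ)` hold; for a 3-sunflower and its complementary 3-sunflower of down-sets conjecturally ONE of the
two products is at most the SQUARE of the kernel mass. [this work] -/
theorem strongCubicMax_nonneg_iff_prod (p : ι → unitInterval) {A B N : Set (Set ι)} (hAB : A \ B ⊆ N) (hBA : B \ A ⊆ N)
    (hN : N ⊆ A ∪ B) (hG : 0 ≤ gladkovDefect p A B N) :
    0 ≤ strongCubicMax p A B N ↔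
      m⟦p, A ∩ N⟧ * m⟦p, B ∩ N⟧ * m⟦p, A ∩ B⟧ ≤ m⟦p, A ∩ B ∩ N⟧ ^ 2 ∨
        m⟦p, Aᶜ⟧ * m⟦p, Bᶜ⟧ * m⟦p, Nᶜ⟧ ≤ m⟦p, (A ∪ B)ᶜ⟧ ^ 2 := by
  rw [strongCubicMax_nonneg_iff p hG]
  have hc := coreSlack_eq_prod p hAB hBA hN
  have ho := outsideSlack_eq_prod p hAB hBA hN
  constructor
  · rintro (h | h)
    · left; linarith
    · right; linarith
  · rintro (h | h)
    · left; linarith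
    · right; linarith

/-- For up-sets the dichotomy in product form, with Gladkov discharged. [this work] -/
theorem strongCubicMax_nonneg_iff_prod_of_isUpperSet (p : ι → unitInterval) {A B N : Set (Set ι)} (hA : IsUpperSet A)
    (hB : IsUpperSet B) (hNup : IsUpperSet N) (hAB : A \ B ⊆ N) (hBA : B \ A ⊆ N) (hN : N ⊆ A ∪ B) :
    0 ≤ strongCubicMax p A B N ↔
      m⟦p, A ∩ N⟧ * m⟦p, B ∩ N⟧ * m⟦p, A ∩ B⟧ ≤ m⟦p, A ∩ B ∩ N⟧ ^ 2 ∨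
        m⟦p, Aᶜ⟧ * m⟦p, Bᶜ⟧ * m⟦p, Nᶜ⟧ ≤ m⟦p, (A ∪ B)ᶜ⟧ ^ 2 :=
  strongCubicMax_nonneg_iff_prod p hAB hBA hN (gladkovDefect_nonneg p hA hB hNup hAB hBA hN)

/-! ### 2. What Harris alone gives: `Π μ(U_i) ≤ μ(K)^{3/2}`, i.e. `(Π μ(U_i))² ≤ μ(K)³` -/

/-- **Harris on the sunflower, squared**: for a sandwiched triple of up-sets
`(μ(A∩N)·μ(B∩N)·μ(A∩B))² ≤ μ(A∩B∩N)³` — the product of the three pairwise Harris inequalities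
`μ(U_i)μ(U_j) ≤ μ(U_i ∩ U_j) = μ(K)`.  The conjectured core branch `Π μ(U_i) ≤ μ(K)²` is the strictly stronger
exponent `2 > 3/2`; this lemma records exactly how far first-order Harris reaches. [this work] -/
theorem prod_sunflower_sq_le_core_cube (p : ι → unitInterval) {A B N : Set (Set ι)} (hA : IsUpperSet A)
    (hB : IsUpperSet B) (hNup : IsUpperSet N) :
    (m⟦p, A ∩ N⟧ * m⟦p, B ∩ N⟧ * m⟦p, A ∩ B⟧) ^ 2 ≤ m⟦p, A ∩ B ∩ N⟧ ^ 3 := by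
  -- the three pairwise intersections are the core
  have hK1 : (A ∩ N) ∩ (B ∩ N) = A ∩ B ∩ N := by
    ext ω; constructor
    · rintro ⟨⟨ha, hn⟩, hb, -⟩; exact ⟨⟨ha, hb⟩, hn⟩
    · rintro ⟨⟨ha, hb⟩, hn⟩; exact ⟨⟨ha, hn⟩, hb, hn⟩
  have hK2 : (A ∩ N) ∩ (A ∩ B) = A ∩ B ∩ N := by
    ext ω; constructor
    · rintro ⟨⟨ha, hn⟩, -, hb⟩; exact ⟨⟨ha, hb⟩, hn⟩
    · rintro ⟨⟨ha, hb⟩, hn⟩; exact ⟨⟨ha, hn⟩, ha, hb⟩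
  have hK3 : (B ∩ N) ∩ (A ∩ B) = A ∩ B ∩ N := by
    ext ω; constructor
    · rintro ⟨⟨hb, hn⟩, ha, -⟩; exact ⟨⟨ha, hb⟩, hn⟩
    · rintro ⟨⟨ha, hb⟩, hn⟩; exact ⟨⟨hb, hn⟩, ha, hb⟩
  have hU1 : IsUpperSet (A ∩ N) := hA.inter hNup
  have hU2 : IsUpperSet (B ∩ N) := hB.inter hNup
  have hU3 : IsUpperSet (A ∩ B) := hA.inter hB
  have h12 := harris_inter p hU1 hU2
  have h13 := harris_inter p hU1 hU3
  have h23 := harris_inter p hU2 hU3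
  rw [hK1] at h12; rw [hK2] at h13; rw [hK3] at h23
  have n1 := mass_nonneg' p (A ∩ N); have n2 := mass_nonneg' p (B ∩ N); have n3 := mass_nonneg' p (A ∩ B)
  have e : (m⟦p, A ∩ N⟧ * m⟦p, B ∩ N⟧ * m⟦p, A ∩ B⟧) ^ 2
      = (m⟦p, A ∩ N⟧ * m⟦p, B ∩ N⟧) * (m⟦p, A ∩ N⟧ * m⟦p, A ∩ B⟧) * (m⟦p, B ∩ N⟧ * m⟦p, A ∩ B⟧) := by ring
  rw [e]
  have hκ := mass_nonneg' p (A ∩ B ∩ N)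
  have s1 : (m⟦p, A ∩ N⟧ * m⟦p, B ∩ N⟧) * (m⟦p, A ∩ N⟧ * m⟦p, A ∩ B⟧)
      ≤ m⟦p, A ∩ B ∩ N⟧ * m⟦p, A ∩ B ∩ N⟧ :=
    mul_le_mul h12 h13 (mul_nonneg n1 n3) hκ
  have s2 : (m⟦p, A ∩ N⟧ * m⟦p, B ∩ N⟧) * (m⟦p, A ∩ N⟧ * m⟦p, A ∩ B⟧) * (m⟦p, B ∩ N⟧ * m⟦p, A ∩ B⟧)
      ≤ m⟦p, A ∩ B ∩ N⟧ * m⟦p, A ∩ B ∩ N⟧ * m⟦p, A ∩ B ∩ N⟧ :=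
    mul_le_mul s1 h23 (mul_nonneg n2 n3) (mul_nonneg hκ hκ)
  calc (m⟦p, A ∩ N⟧ * m⟦p, B ∩ N⟧) * (m⟦p, A ∩ N⟧ * m⟦p, A ∩ B⟧) * (m⟦p, B ∩ N⟧ * m⟦p, A ∩ B⟧)
      ≤ m⟦p, A ∩ B ∩ N⟧ * m⟦p, A ∩ B ∩ N⟧ * m⟦p, A ∩ B ∩ N⟧ := s2
    _ = m⟦p, A ∩ B ∩ N⟧ ^ 3 := by ring

/-! ### 3. The co-sunflower of three arbitrary increasing events -/

/-- **S₃^max for the co-sunflower `(G₂∪G₃, G₁∪G₃, G₁∪G₂)` in product form.**  With `K = "at least two G_i"`,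
`O = "no G_i"`, `U_i = K ∪ "only G_i" = (G_j∪G_k... )`: here `A∩N = (G₂∪G₃)∩(G₁∪G₂)`, `B∩N = (G₁∪G₃)∩(G₁∪G₂)`,
`A∩B = (G₂∪G₃)∩(G₁∪G₃)`, `Aᶜ = (G₂∪G₃)ᶜ` etc., so S₃^max for the class reads
`μ((G₂∪G₃)∩(G₁∪G₂))·μ((G₁∪G₃)∩(G₁∪G₂))·μ((G₂∪G₃)∩(G₁∪G₃)) ≤ μ(≥2)²  ∨  μ((G₂∪G₃)ᶜ)μ((G₁∪G₃)ᶜ)μ((G₁∪G₂)ᶜ) ≤ μ(none)²`. [this work] -/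
theorem strongCubicMax_coSunflower_iff_prod (p : ι → unitInterval) {G₁ G₂ G₃ : Set (Set ι)} (h₁ : IsUpperSet G₁)
    (h₂ : IsUpperSet G₂) (h₃ : IsUpperSet G₃) :
    0 ≤ strongCubicMax p (G₂ ∪ G₃) (G₁ ∪ G₃) (G₁ ∪ G₂) ↔
      m⟦p, (G₂ ∪ G₃) ∩ (G₁ ∪ G₂)⟧ * m⟦p, (G₁ ∪ G₃) ∩ (G₁ ∪ G₂)⟧ * m⟦p, (G₂ ∪ G₃) ∩ (G₁ ∪ G₃)⟧
          ≤ m⟦p, (G₂ ∪ G₃) ∩ (G₁ ∪ G₃) ∩ (G₁ ∪ G₂)⟧ ^ 2 ∨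
        m⟦p, (G₂ ∪ G₃)ᶜ⟧ * m⟦p, (G₁ ∪ G₃)ᶜ⟧ * m⟦p, (G₁ ∪ G₂)ᶜ⟧ ≤ m⟦p, ((G₂ ∪ G₃) ∪ (G₁ ∪ G₃))ᶜ⟧ ^ 2 := by
  have hA : IsUpperSet (G₂ ∪ G₃) := h₂.union h₃
  have hB : IsUpperSet (G₁ ∪ G₃) := h₁.union h₃
  have hN : IsUpperSet (G₁ ∪ G₂) := h₁.union h₂
  have hAB : (G₂ ∪ G₃) \ (G₁ ∪ G₃) ⊆ G₁ ∪ G₂ := by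
    rintro ω ⟨h, h'⟩
    rcases h with h2 | h3
    · exact Or.inr h2
    · exact absurd (Or.inr h3) h'
  have hBA : (G₁ ∪ G₃) \ (G₂ ∪ G₃) ⊆ G₁ ∪ G₂ := by
    rintro ω ⟨h, h'⟩
    rcases h with h1 | h3
    · exact Or.inl h1
    · exact absurd (Or.inr h3) h'
  have hNs : G₁ ∪ G₂ ⊆ (G₂ ∪ G₃) ∪ (G₁ ∪ G₃) := by
    rintro ω (h1 | h2)
    · exact Or.inr (Or.inl h1)
    · exact Or.inl (Or.inl h2)
  exact strongCubicMax_nonneg_iff_prod_of_isUpperSet p hA hB hN hAB hBA hNs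

end SahiDeepCore

end Summit.CriticalPhenomena.PercolationContinuityZ3.Theorems
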